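import Summits.FinalStateConjecture.FinalStateConjecture.Theorems.BartnikGapSettlingBondiBartnikRigidityMarchingLemmaChartData
import Summits.FinalStateConjecture.FinalStateConjecture.Theorems.BartnikGapSettlingBondiBartnikRigiditySlabFrontier
import Literature.Geometry.Lorentzian.CausalCurveLift
import Literature.Geometry.Lorentzian.CommonDevelopmentEmbedding
import Literature.Geometry.Lorentzian.ConvergenceTransport
import Literature.Geometry.Lorentzian.CauchyHypersurfaceGlobalHyperbolicity
import Literature.Geometry.Lorentzian.CausalityClosure
import HarnessLib

/-!
# K2b-5 `stub_marchingLemma`, brick 10: causal properties of exact charts — line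
# `direct-method-on-the-cone` (crux `BondiBartnikRigidity`, stmt-FinalStateConjecture-10807)

For an exact, time-orientation preserving chart `Ψ` of the collar background on the pull-back
`pullK Q` of an open Kerr-side set `Q` (notation of `…MarchingLemmaChartData`, `Φ = Ψ ∘ lab`):

* `chart_isIsometricImmersion`, `chart_preservesTimeOrientation` — `Φ|Q : (Q, g_{M,a}) → 𝒮` is a
  time-orientation preserving isometric immersion of the open sub-spacetime `Q` of the star chart;
* `isFutureTimelikeCurveOn_chart_comp`, `isFutureCausalCurveOn_chart_comp` — `Φ` maps Kerr-future
  timelike/causal curves inside `Q` to future timelike/causal curves of `𝒮`;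
* `image_subset_chronologicalFuture` — if `Φ(Q) ⊆ J` then `Φ(Q) ⊆ I⁺(J)` (every point of the open set
  `Q` is the future end of a short timelike curve in `Q`);
* `eq_of_mem_causalFuture_of_time_le` — ACAUSALITY OF THE SLICE IMAGES: if `Φ(Q)` is past-closed in
  `I⁺(C)` (the conclusion of `K2Route.ExactChartPastSet`), `Φ(Q) ⊆ I⁺(C)` and `Φ|Q` is injective, then
  `Φ z₂ ∈ J⁺(Φ z₁)` with `t*(z₂) ≤ t*(z₁)` forces `z₂ = z₁` (lift the causal curve through the injective
  local isometry `Φ|Q`, `IsFutureCausalCurveOn.invFun_comp`; `t*` is strictly increasing along Kerr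
  causal curves, `KerrCausal.strictMonoOn_time`).

References: O'Neill 1983, Ch. 3, pp. 90–91, Ch. 14, p. 402 [ONeill1983]; Dafermos–Rodnianski
arXiv:0811.0354, §5.1 [DafermosRodnianski2008].  No definitions, no named facts.
-/

noncomputable section

-- D-0017: single-problem summit, `Summit.<S>.<S>.…` by design (cf. lakefile `weak.linter.dupNamespace`).
set_option linter.dupNamespace false
set_option maxSynthPendingDepth 3

open Set Filter Function Topology TopologicalSpace Bundle
open Literature.Geometry.Lorentzian
open scoped Manifold ContDiff Topology ENNReal

namespace Summit.FinalStateConjecture.FinalStateConjecture.Theorems.BondiBartnikRigidity.DirectMethod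

namespace ChartCausal

open ChartData (lab_mem_pullK_iff contMDiffAt_chart val_mfderiv_chart eq_zero_of_mfderiv_chart_eq_zero)

variable [Kerr.Facts] {𝒮 : Spacetime.{0} 4} {mo : lorentzGroup × E4} {M a : ℝ} {B : ModelBackground}
  {Ψ : B.domain → 𝒮.carrier} {lab : Kerr.region a M → B.domain} {Q : Set (Kerr.region a M)}

/-! ### The chart as an isometric immersion of the open sub-spacetime `Q` -/

/-- **`Φ|Q` is a smooth isometric immersion of `(Q, g_{M,a})` into `𝒮`.** [cite: ONeill1983, Ch. 3, pp. 90–91] -/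
theorem chart_isIsometricImmersion (hM : 0 < M) (hlab : ∀ z, (lab z : E4) = (mo.1 : E4 ≃L[ℝ] E4) z.1 + mo.2)
    (hQ : IsOpen Q) (hB : B = starBackground mo.1 mo.2 M a (fun x => Kerr.radius a (poincareInv mo.1 mo.2 x)))
    (hs : ContMDiffOn 𝓘(ℝ, E4) (𝓡 4) ∞ Ψ (pullK mo M a B Q))
    (hd : supCkENorm (Subtype.val '' pullK mo M a B Q) 0 (𝒮.deviationExtend B Ψ) ≤ 0) :
    ContMDiff 𝓘(ℝ, E4) (𝓡 4) ∞ (fun q : (⟨Q, hQ⟩ : Opens (Kerr.spacetime M a M hM.le).carrier) => Ψ (lab q.1)) ∧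
    (∀ q : (⟨Q, hQ⟩ : Opens (Kerr.spacetime M a M hM.le).carrier),
      mfderiv 𝓘(ℝ, E4) (𝓡 4) (fun q : (⟨Q, hQ⟩ : Opens (Kerr.spacetime M a M hM.le).carrier) => Ψ (lab q.1)) q =
        mfderiv 𝓘(ℝ, E4) (𝓡 4) (Ψ ∘ lab) q.1) ∧
    ∀ q : (⟨Q, hQ⟩ : Opens (Kerr.spacetime M a M hM.le).carrier),
      pullbackBilin (I := 𝓡 4) (I' := 𝓘(ℝ, E4))
        (fun q : (⟨Q, hQ⟩ : Opens (Kerr.spacetime M a M hM.le).carrier) => Ψ (lab q.1)) 𝒮.metric.val q =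
      ((Kerr.spacetime M a M hM.le).metric.restrict PseudoRiemannianMetric.contMDiff_restrict_holds
        (⟨Q, hQ⟩ : Opens (Kerr.spacetime M a M hM.le).carrier)).val q := by
  set Q' : Opens (Kerr.spacetime M a M hM.le).carrier := ⟨Q, hQ⟩
  set ΦQ : Q' → 𝒮.carrier := fun q => Ψ (lab q.1)
  have hΦQs : ContMDiff 𝓘(ℝ, E4) (𝓡 4) ∞ ΦQ := fun q =>
    (contMDiffAt_chart hlab hQ hB hs q.2).1.comp q (contMDiff_subtype_val q)
  have hdΦQ : ∀ q : Q', mfderiv 𝓘(ℝ, E4) (𝓡 4) ΦQ q = mfderiv 𝓘(ℝ, E4) (𝓡 4) (Ψ ∘ lab) q.1 := fun q =>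
    mfderiv_comp_subtypeVal ((contMDiffAt_chart hlab hQ hB hs q.2).1.mdifferentiableAt (by simp))
  refine ⟨hΦQs, hdΦQ, fun q => ?_⟩
  ext u u'
  rw [pullbackBilin_apply, hdΦQ q]
  exact val_mfderiv_chart hlab hQ hB hs hd q.2 u u'

/-- **`Φ|Q` preserves the time orientation** (`dΦ (V) = dΨ (ΛV)` is future-directed by the orientation
clause of exact charts). [cite: ONeill1983, Ch. 5, p. 145] -/
theorem chart_preservesTimeOrientation (hM : 0 < M)
    (hlab : ∀ z, (lab z : E4) = (mo.1 : E4 ≃L[ℝ] E4) z.1 + mo.2)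
    (hQ : IsOpen Q) (hB : B = starBackground mo.1 mo.2 M a (fun x => Kerr.radius a (poincareInv mo.1 mo.2 x)))
    (hs : ContMDiffOn 𝓘(ℝ, E4) (𝓡 4) ∞ Ψ (pullK mo M a B Q))
    (htop : ∀ x ∈ pullK mo M a B Q, 𝒮.timeOrientation.IsFutureDirected
      (mfderiv 𝓘(ℝ, E4) (𝓡 4) Ψ x ((mo.1 : E4 ≃L[ℝ] E4) (Kerr.timeVector M a (poincareInv mo.1 mo.2 x.1))))) :
    ((Kerr.spacetime M a M hM.le).timeOrientation.restrict PseudoRiemannianMetric.contMDiff_restrict_holds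
        (Kerr.spacetime M a M hM.le).timeOrientation.contMDiff_restrict_holds
        (⟨Q, hQ⟩ : Opens (Kerr.spacetime M a M hM.le).carrier)).PreservesTimeOrientation
      (fun q : (⟨Q, hQ⟩ : Opens (Kerr.spacetime M a M hM.le).carrier) => Ψ (lab q.1)) 𝒮.timeOrientation := by
  intro q
  set z : Kerr.region a M := q.1 with hz
  have hzQ : z ∈ Q := q.2
  have hdΦQ : mfderiv 𝓘(ℝ, E4) (𝓡 4) (fun q : (⟨Q, hQ⟩ : Opens (Kerr.spacetime M a M hM.le).carrier) =>
      Ψ (lab q.1)) q = mfderiv 𝓘(ℝ, E4) (𝓡 4) (Ψ ∘ lab) z :=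
    mfderiv_comp_subtypeVal ((contMDiffAt_chart hlab hQ hB hs hzQ).1.mdifferentiableAt (by simp))
  have key : 𝒮.timeOrientation.IsFutureDirected (mfderiv 𝓘(ℝ, E4) (𝓡 4) (Ψ ∘ lab) z (Kerr.timeVector M a z.1)) := by
    rw [(contMDiffAt_chart hlab hQ hB hs hzQ).2]
    have h := htop (lab z) ((lab_mem_pullK_iff hlab z).2 hzQ)
    have hP : poincareInv mo.1 mo.2 (lab z).1 = z.1 := by rw [hlab, F1Route.poincareInv_lab]
    rw [hP] at h
    exact h
  show 𝒮.timeOrientation.IsFutureDirected (mfderiv 𝓘(ℝ, E4) (𝓡 4)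
    (fun q : (⟨Q, hQ⟩ : Opens (Kerr.spacetime M a M hM.le).carrier) => Ψ (lab q.1)) q (Kerr.timeVector M a z.1))
  rw [hdΦQ]
  exact key

/-! ### Images of Kerr causal curves -/

/-- **`Φ` maps Kerr-future causal curves inside `Q` to future causal curves of `𝒮`.**
[cite: ONeill1983, Ch. 14, p. 402] -/
theorem isFutureCausalCurveOn_chart_comp (hM : 0 < M)
    (hlab : ∀ z, (lab z : E4) = (mo.1 : E4 ≃L[ℝ] E4) z.1 + mo.2)
    (hQ : IsOpen Q) (hB : B = starBackground mo.1 mo.2 M a (fun x => Kerr.radius a (poincareInv mo.1 mo.2 x)))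
    (hs : ContMDiffOn 𝓘(ℝ, E4) (𝓡 4) ∞ Ψ (pullK mo M a B Q))
    (hd : supCkENorm (Subtype.val '' pullK mo M a B Q) 0 (𝒮.deviationExtend B Ψ) ≤ 0)
    (htop : ∀ x ∈ pullK mo M a B Q, 𝒮.timeOrientation.IsFutureDirected
      (mfderiv 𝓘(ℝ, E4) (𝓡 4) Ψ x ((mo.1 : E4 ≃L[ℝ] E4) (Kerr.timeVector M a (poincareInv mo.1 mo.2 x.1)))))
    {γ : ℝ → Kerr.region a M} {s : Set ℝ}
    (hγ : (Kerr.smoothMetric M a M).IsFutureCausalCurveOn ((Kerr.timeOrientation M a M hM.le).ofLE le_top) γ s)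
    (hγQ : ∀ t ∈ s, γ t ∈ Q) :
    𝒮.metric.IsFutureCausalCurveOn 𝒮.timeOrientation (fun t => Ψ (lab (γ t))) s := by
  intro t ht
  obtain ⟨hdiff, hfd⟩ := hγ t ht
  obtain ⟨hΦat, hdΦ⟩ := contMDiffAt_chart hlab hQ hB hs (hγQ t ht)
  have hcomp : (fun t => Ψ (lab (γ t))) = (Ψ ∘ lab) ∘ γ := rfl
  have hvel : velocity (𝓡 4) (fun t => Ψ (lab (γ t))) t =
      mfderiv 𝓘(ℝ, E4) (𝓡 4) (Ψ ∘ lab) (γ t) (velocity 𝓘(ℝ, E4) γ t) := by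
    unfold velocity
    rw [hcomp, mfderiv_comp t (hΦat.mdifferentiableAt (by simp)) hdiff]; rfl
  refine ⟨(hΦat.mdifferentiableAt (by simp)).comp t hdiff, ?_⟩
  rw [hvel]
  -- the cone computation at `γ t`
  obtain ⟨⟨hc, hne⟩, hfd'⟩ := hfd
  have hc' : Kerr.bilin M a (γ t).1 (velocity 𝓘(ℝ, E4) γ t) (velocity 𝓘(ℝ, E4) γ t) ≤ 0 := hc
  have hfd'' : Kerr.bilin M a (γ t).1 (Kerr.timeVector M a (γ t).1) (velocity 𝓘(ℝ, E4) γ t) < 0 := hfd'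
  have hiso := val_mfderiv_chart hlab hQ hB hs hd (hγQ t ht)
  have hzr : 0 < Kerr.radius a (γ t).1 := Kerr.radius_pos_of_mem_region (γ t).2
  -- `dΦ V` is future-directed timelike
  have hV : 𝒮.timeOrientation.IsFutureDirected
      (mfderiv 𝓘(ℝ, E4) (𝓡 4) (Ψ ∘ lab) (γ t) (Kerr.timeVector M a (γ t).1)) := by
    rw [hdΦ]
    have h := htop (lab (γ t)) ((lab_mem_pullK_iff hlab (γ t)).2 (hγQ t ht))
    have hP : poincareInv mo.1 mo.2 (lab (γ t)).1 = (γ t).1 := by rw [hlab, F1Route.poincareInv_lab]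
    rw [hP] at h
    exact h
  have hVt : 𝒮.metric.IsTimelike (mfderiv 𝓘(ℝ, E4) (𝓡 4) (Ψ ∘ lab) (γ t) (Kerr.timeVector M a (γ t).1)) := by
    show 𝒮.metric.val _ _ _ < 0
    rw [hiso]
    exact Kerr.bilin_timeVector_timeVector_neg hM.le a hzr
  refine TimeOrientation.isFutureDirected_of_val_lt_zero 𝒮.timeOrientation hV hVt ⟨?_, ?_⟩ ?_
  · show 𝒮.metric.val ((Ψ ∘ lab) (γ t)) (mfderiv 𝓘(ℝ, E4) (𝓡 4) (Ψ ∘ lab) (γ t) (velocity 𝓘(ℝ, E4) γ t))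
      (mfderiv 𝓘(ℝ, E4) (𝓡 4) (Ψ ∘ lab) (γ t) (velocity 𝓘(ℝ, E4) γ t)) ≤ 0
    rw [hiso]; exact hc'
  · intro h0
    exact hne (eq_zero_of_mfderiv_chart_eq_zero hlab hQ hB hs hd (hγQ t ht) h0)
  · show 𝒮.metric.val ((Ψ ∘ lab) (γ t)) (mfderiv 𝓘(ℝ, E4) (𝓡 4) (Ψ ∘ lab) (γ t) (Kerr.timeVector M a (γ t).1))
      (mfderiv 𝓘(ℝ, E4) (𝓡 4) (Ψ ∘ lab) (γ t) (velocity 𝓘(ℝ, E4) γ t)) < 0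
    rw [hiso]; exact hfd''

/-- **`Φ` maps Kerr-future timelike curves inside `Q` to future timelike curves of `𝒮`.**
[cite: ONeill1983, Ch. 14, p. 402] -/
theorem isFutureTimelikeCurveOn_chart_comp (hM : 0 < M)
    (hlab : ∀ z, (lab z : E4) = (mo.1 : E4 ≃L[ℝ] E4) z.1 + mo.2)
    (hQ : IsOpen Q) (hB : B = starBackground mo.1 mo.2 M a (fun x => Kerr.radius a (poincareInv mo.1 mo.2 x)))
    (hs : ContMDiffOn 𝓘(ℝ, E4) (𝓡 4) ∞ Ψ (pullK mo M a B Q))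
    (hd : supCkENorm (Subtype.val '' pullK mo M a B Q) 0 (𝒮.deviationExtend B Ψ) ≤ 0)
    (htop : ∀ x ∈ pullK mo M a B Q, 𝒮.timeOrientation.IsFutureDirected
      (mfderiv 𝓘(ℝ, E4) (𝓡 4) Ψ x ((mo.1 : E4 ≃L[ℝ] E4) (Kerr.timeVector M a (poincareInv mo.1 mo.2 x.1)))))
    {γ : ℝ → Kerr.region a M} {s : Set ℝ}
    (hγ : (Kerr.smoothMetric M a M).IsFutureTimelikeCurveOn ((Kerr.timeOrientation M a M hM.le).ofLE le_top) γ s)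
    (hγQ : ∀ t ∈ s, γ t ∈ Q) :
    𝒮.metric.IsFutureTimelikeCurveOn 𝒮.timeOrientation (fun t => Ψ (lab (γ t))) s := by
  intro t ht
  obtain ⟨hd1, hfd1⟩ := isFutureCausalCurveOn_chart_comp hM hlab hQ hB hs hd htop hγ.isFutureCausalCurveOn hγQ t ht
  refine ⟨hd1, ?_, hfd1⟩
  obtain ⟨hdiff, htl, -⟩ := hγ t ht
  obtain ⟨hΦat, -⟩ := contMDiffAt_chart hlab hQ hB hs (hγQ t ht)
  have hcomp : (fun t => Ψ (lab (γ t))) = (Ψ ∘ lab) ∘ γ := rfl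
  have hvel : velocity (𝓡 4) (fun t => Ψ (lab (γ t))) t =
      mfderiv 𝓘(ℝ, E4) (𝓡 4) (Ψ ∘ lab) (γ t) (velocity 𝓘(ℝ, E4) γ t) := by
    unfold velocity
    rw [hcomp, mfderiv_comp t (hΦat.mdifferentiableAt (by simp)) hdiff]; rfl
  have htl' : Kerr.bilin M a (γ t).1 (velocity 𝓘(ℝ, E4) γ t) (velocity 𝓘(ℝ, E4) γ t) < 0 := htl
  rw [hvel]
  show 𝒮.metric.val ((Ψ ∘ lab) (γ t)) (mfderiv 𝓘(ℝ, E4) (𝓡 4) (Ψ ∘ lab) (γ t) (velocity 𝓘(ℝ, E4) γ t))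
    (mfderiv 𝓘(ℝ, E4) (𝓡 4) (Ψ ∘ lab) (γ t) (velocity 𝓘(ℝ, E4) γ t)) < 0
  rw [val_mfderiv_chart hlab hQ hB hs hd (hγQ t ht)]
  exact htl'

/-! ### Images lie in the chronological future of the image set -/

/-- **`Φ(Q) ⊆ I⁺(J)` whenever `Φ(Q) ⊆ J`**: every point `z` of the open set `Q` is the future end of a
short Kerr-timelike curve inside `Q` (a timelike curve through `z` exists, `CausalityClosure`), whose
image is a future timelike curve of `𝒮` from a point of `J` to `Φ z`. [cite: ONeill1983, Ch. 14, p. 402] -/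
theorem image_subset_chronologicalFuture (hM : 0 < M)
    (hlab : ∀ z, (lab z : E4) = (mo.1 : E4 ≃L[ℝ] E4) z.1 + mo.2)
    (hQ : IsOpen Q) (hB : B = starBackground mo.1 mo.2 M a (fun x => Kerr.radius a (poincareInv mo.1 mo.2 x)))
    (hs : ContMDiffOn 𝓘(ℝ, E4) (𝓡 4) ∞ Ψ (pullK mo M a B Q))
    (hd : supCkENorm (Subtype.val '' pullK mo M a B Q) 0 (𝒮.deviationExtend B Ψ) ≤ 0)
    (htop : ∀ x ∈ pullK mo M a B Q, 𝒮.timeOrientation.IsFutureDirected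
      (mfderiv 𝓘(ℝ, E4) (𝓡 4) Ψ x ((mo.1 : E4 ≃L[ℝ] E4) (Kerr.timeVector M a (poincareInv mo.1 mo.2 x.1)))))
    {J : Set 𝒮.carrier} (hΨJ : Ψ '' pullK mo M a B Q ⊆ J) :
    Ψ '' pullK mo M a B Q ⊆ 𝒮.metric.chronologicalFuture 𝒮.timeOrientation J := by
  rintro _ ⟨x, hx, rfl⟩
  obtain ⟨hreg, hzQ⟩ := hx
  set z : Kerr.region a M := ⟨poincareInv mo.1 mo.2 x.1, hreg⟩ with hz
  have hlabz : lab z = x := Subtype.ext (by rw [hlab]; exact F1Route.lab_poincareInv mo x.1)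
  -- a timelike curve through `z`, and a past piece of it inside `Q`
  obtain ⟨μ, ε, hε, hμ0, hμ⟩ := LorentzianMetric.exists_isFutureTimelikeCurveOn_Ioo_of_isInteriorPoint
    (g := Kerr.smoothMetric M a M) (τ := (Kerr.timeOrientation M a M hM.le).ofLE le_top)
    (BoundarylessManifold.isInteriorPoint (I := 𝓘(ℝ, E4)) (x := z))
  have hc0 : ContinuousAt μ 0 := (hμ 0 ⟨by linarith, hε⟩).1.continuousAt
  have hpre : μ ⁻¹' Q ∈ 𝓝 (0 : ℝ) := hc0.preimage_mem_nhds (hQ.mem_nhds (by rw [hμ0]; exact hzQ))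
  obtain ⟨δ₀, hδ₀, hball⟩ := Metric.mem_nhds_iff.1 hpre
  set δ := min δ₀ ε / 2 with hδ
  have hδp : 0 < δ := by positivity
  have hδ₁ : δ < δ₀ := by
    have := min_le_left δ₀ ε; rw [hδ]; linarith
  have hδ₂ : δ < ε := by
    have := min_le_right δ₀ ε; rw [hδ]; linarith
  have hμQ : ∀ t ∈ Icc (-δ) 0, μ t ∈ Q := fun t ht =>
    hball (by rw [Metric.mem_ball, dist_zero_right, Real.norm_eq_abs, abs_lt]; constructor <;> linarith [ht.1, ht.2])
  have hμ' : (Kerr.smoothMetric M a M).IsFutureTimelikeCurveOn ((Kerr.timeOrientation M a M hM.le).ofLE le_top)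
      μ (Icc (-δ) 0) := hμ.mono fun t ht => ⟨by linarith [ht.1], by linarith [ht.2]⟩
  have himg := isFutureTimelikeCurveOn_chart_comp hM hlab hQ hB hs hd htop hμ' hμQ
  refine ⟨Ψ (lab (μ (-δ))), hΨJ ⟨lab (μ (-δ)), (lab_mem_pullK_iff hlab _).2 (hμQ _ ⟨le_rfl, by linarith⟩), rfl⟩,
    fun t => Ψ (lab (μ t)), -δ, 0, by linarith, himg, rfl, ?_⟩
  show Ψ (lab (μ 0)) = Ψ x
  rw [hμ0, hlabz]

/-! ### Acausality of the slice images -/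

/-- A future causal curve of the open sub-spacetime `Q` (restricted metric) is a Kerr-future causal
curve of the chart (same velocity, same metric and orientation at the point). [folklore] -/
theorem isFutureCausalCurveOn_val_comp (hM : 0 < M) (hQ : IsOpen Q)
    {c : ℝ → (⟨Q, hQ⟩ : Opens (Kerr.spacetime M a M hM.le).carrier)} {s : Set ℝ}
    (hc : ((Kerr.spacetime M a M hM.le).metric.restrict PseudoRiemannianMetric.contMDiff_restrict_holds
        (⟨Q, hQ⟩ : Opens (Kerr.spacetime M a M hM.le).carrier)).IsFutureCausalCurveOn
      ((Kerr.spacetime M a M hM.le).timeOrientation.restrict PseudoRiemannianMetric.contMDiff_restrict_holds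
        (Kerr.spacetime M a M hM.le).timeOrientation.contMDiff_restrict_holds
        (⟨Q, hQ⟩ : Opens (Kerr.spacetime M a M hM.le).carrier)) c s) :
    (Kerr.smoothMetric M a M).IsFutureCausalCurveOn ((Kerr.timeOrientation M a M hM.le).ofLE le_top)
      (fun t => ((c t).1 : Kerr.region a M)) s := by
  intro t ht
  obtain ⟨hdiff, ⟨hc', hne⟩, hfd⟩ := hc t ht
  have hv := velocity_subtypeVal_comp (I := 𝓘(ℝ, E4)) (⟨Q, hQ⟩ : Opens (Kerr.spacetime M a M hM.le).carrier) c t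
  have hd' : MDifferentiableAt 𝓘(ℝ, ℝ) 𝓘(ℝ, E4) (fun t => ((c t).1 : Kerr.region a M)) t :=
    (mdifferentiableAt_subtypeVal_comp_curve_iff (I := 𝓘(ℝ, E4))
      (⟨Q, hQ⟩ : Opens (Kerr.spacetime M a M hM.le).carrier)).2 hdiff
  refine ⟨hd', ⟨?_, ?_⟩, ?_⟩
  · show Kerr.bilin M a ((c t).1 : Kerr.region a M).1 (velocity 𝓘(ℝ, E4) (Subtype.val ∘ c) t)
      (velocity 𝓘(ℝ, E4) (Subtype.val ∘ c) t) ≤ 0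
    rw [hv]; exact hc'
  · show (velocity 𝓘(ℝ, E4) (Subtype.val ∘ c) t : E4) ≠ 0
    rw [hv]; exact hne
  · show Kerr.bilin M a ((c t).1 : Kerr.region a M).1 (Kerr.timeVector M a ((c t).1 : Kerr.region a M).1)
      (velocity 𝓘(ℝ, E4) (Subtype.val ∘ c) t) < 0
    rw [hv]; exact hfd

/-- **Acausality of the images of Kerr-time levels under an exact chart with past-closed image.**  If
`Φ(Q)` is past-closed in `I⁺(C)` (conclusion of `K2Route.ExactChartPastSet`), `Φ(Q) ⊆ I⁺(C)` and `Ψ` is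
injective on `pullK Q`, then `Φ z₂ ∈ J⁺(Φ z₁)` with `t*(z₂) ≤ t*(z₁)` forces `z₂ = z₁`: a causal curve from
`Φ z₁` to `Φ z₂` lies in `J⁻(Φ z₂) ∩ I⁺(C) ⊆ Φ(Q)` and lifts through the injective local isometry `Φ|Q` to a
Kerr-causal curve from `z₁` to `z₂`, along which `t*` strictly increases. [cite: DafermosRodnianski2008, §5.1] -/
theorem eq_of_mem_causalFuture_of_time_le (hM : 0 < M)
    (hlab : ∀ z, (lab z : E4) = (mo.1 : E4 ≃L[ℝ] E4) z.1 + mo.2)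
    (hQ : IsOpen Q) (hB : B = starBackground mo.1 mo.2 M a (fun x => Kerr.radius a (poincareInv mo.1 mo.2 x)))
    (hs : ContMDiffOn 𝓘(ℝ, E4) (𝓡 4) ∞ Ψ (pullK mo M a B Q))
    (hinj : InjOn Ψ (pullK mo M a B Q))
    (hd : supCkENorm (Subtype.val '' pullK mo M a B Q) 0 (𝒮.deviationExtend B Ψ) ≤ 0)
    (htop : ∀ x ∈ pullK mo M a B Q, 𝒮.timeOrientation.IsFutureDirected
      (mfderiv 𝓘(ℝ, E4) (𝓡 4) Ψ x ((mo.1 : E4 ≃L[ℝ] E4) (Kerr.timeVector M a (poincareInv mo.1 mo.2 x.1)))))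
    {C : Set 𝒮.carrier}
    (hpast : ∀ x ∈ pullK mo M a B Q, 𝒮.metric.causalPast 𝒮.timeOrientation {Ψ x} ∩
      𝒮.metric.chronologicalFuture 𝒮.timeOrientation C ⊆ Ψ '' pullK mo M a B Q)
    (hQI : Ψ '' pullK mo M a B Q ⊆ 𝒮.metric.chronologicalFuture 𝒮.timeOrientation C)
    {z₁ z₂ : Kerr.region a M} (hz₁ : z₁ ∈ Q) (hz₂ : z₂ ∈ Q)
    (h : Ψ (lab z₂) ∈ 𝒮.metric.causalFuture 𝒮.timeOrientation {Ψ (lab z₁)}) (ht : z₂.1 0 ≤ z₁.1 0) :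
    z₂ = z₁ := by
  have hn1 : (1 : ℕ∞ω) ≤ (∞ : ℕ∞ω) := by exact_mod_cast le_top
  have hlabinj : ∀ {w w' : Kerr.region a M}, w ∈ Q → w' ∈ Q → Ψ (lab w) = Ψ (lab w') → w = w' := by
    intro w w' hw hw' he
    have := hinj ((lab_mem_pullK_iff hlab w).2 hw) ((lab_mem_pullK_iff hlab w').2 hw') he
    have h1 : (lab w : E4) = lab w' := congrArg Subtype.val this
    rw [hlab, hlab] at h1
    exact Subtype.ext ((mo.1 : E4 ≃L[ℝ] E4).injective (add_right_cancel h1))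
  rcases h with h | ⟨p, hp, c, b₀, b₁, hb, hc, hcp, hcq⟩
  · exact hlabinj hz₂ hz₁ (mem_singleton_iff.1 h)
  · exfalso
    rw [mem_singleton_iff] at hp
    subst hp
    -- the curve lies in `Φ(Q)`
    have hx₁ : lab z₁ ∈ pullK mo M a B Q := (lab_mem_pullK_iff hlab z₁).2 hz₁
    have hx₂ : lab z₂ ∈ pullK mo M a B Q := (lab_mem_pullK_iff hlab z₂).2 hz₂
    have hcQ : ∀ t ∈ Icc b₀ b₁, c t ∈ Ψ '' pullK mo M a B Q := by
      intro t ht'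
      refine hpast (lab z₂) hx₂ ⟨?_, ?_⟩
      · -- `c t ∈ J⁻(Φ z₂)`
        refine LorentzianMetric.mem_causalPast_of_mem_causalFuture ?_
        rcases eq_or_lt_of_le ht'.2 with heq | hlt
        · rw [heq, hcq]; exact Or.inl (mem_singleton _)
        · exact Or.inr ⟨c t, mem_singleton _, c, t, b₁, hlt, hc.mono (Icc_subset_Icc ht'.1 le_rfl), rfl, hcq⟩
      · -- `c t ∈ I⁺(C)`
        have hp : Ψ (lab z₁) ∈ 𝒮.metric.chronologicalFuture 𝒮.timeOrientation C := hQI ⟨_, hx₁, rfl⟩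
        rcases eq_or_lt_of_le ht'.1 with heq | hlt
        · rw [← heq, hcp]; exact hp
        · exact LorentzianMetric.mem_chronologicalFuture_of_mem_chronologicalFuture_of_mem_causalFuture_set hn1 hp
            (Or.inr ⟨_, mem_singleton _, c, b₀, t, hlt, hc.mono (Icc_subset_Icc le_rfl ht'.2), hcp, rfl⟩)
    -- the injective local isometry `Φ|Q`
    set Q' : Opens (Kerr.spacetime M a M hM.le).carrier := ⟨Q, hQ⟩
    set ΦQ : Q' → 𝒮.carrier := fun q => Ψ (lab q.1)
    haveI : Nonempty Q' := ⟨⟨z₁, hz₁⟩⟩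
    obtain ⟨hΦs, -, hΦi⟩ := chart_isIsometricImmersion hM hlab hQ hB hs hd
    have hΦt := chart_preservesTimeOrientation hM hlab hQ hB hs htop
    have hΦI : (((Kerr.spacetime M a M hM.le).metric.restrict PseudoRiemannianMetric.contMDiff_restrict_holds
        Q')).IsIsometricImmersion 𝒮.metric.toPseudoRiemannianMetric ΦQ := ⟨hΦs, hΦi⟩
    have hΦinj : Injective ΦQ := fun q q' he => Subtype.ext (hlabinj q.2 q'.2 he)
    have hloc := LorentzianMetric.isLocalDiffeomorph_of_isIsometricImmersion hΦI
    have hrange : ∀ t ∈ Icc b₀ b₁, c t ∈ range ΦQ := by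
      intro t ht'
      obtain ⟨x, ⟨hreg, hxQ⟩, hx⟩ := hcQ t ht'
      refine ⟨⟨⟨poincareInv mo.1 mo.2 x.1, hreg⟩, hxQ⟩, ?_⟩
      show Ψ (lab ⟨poincareInv mo.1 mo.2 x.1, hreg⟩) = c t
      rw [← hx]; congr 1
      exact Subtype.ext (by rw [hlab]; exact F1Route.lab_poincareInv mo x.1)
    -- the lifted Kerr-causal curve from `z₁` to `z₂`
    have hlift := hc.invFun_comp hΦI hΦt hΦinj hloc hrange
    have hK := isFutureCausalCurveOn_val_comp hM hQ hlift
    have hmono := KerrCausal.strictMonoOn_time ordConnected_Icc hK (left_mem_Icc.2 hb.le) (right_mem_Icc.2 hb.le) hb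
    have hend : ∀ {t} {w : Kerr.region a M} (hw : w ∈ Q), c t = Ψ (lab w) → t ∈ Icc b₀ b₁ →
        (((Function.invFun ΦQ ∘ c) t).1 : Kerr.region a M) = w := by
      intro t w hw hct ht'
      have h1 : ΦQ ((Function.invFun ΦQ ∘ c) t) = c t := Function.invFun_eq (hrange t ht')
      rw [hct] at h1
      exact hlabinj ((Function.invFun ΦQ ∘ c) t).2 hw h1
    simp only [comp_apply] at hmono
    rw [show ((Function.invFun ΦQ (c b₀)).1 : Kerr.region a M) = z₁ from hend hz₁ hcp (left_mem_Icc.2 hb.le),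
      show ((Function.invFun ΦQ (c b₁)).1 : Kerr.region a M) = z₂ from hend hz₂ hcq (right_mem_Icc.2 hb.le)] at hmono
    exact absurd hmono (not_lt.2 ht)

end ChartCausal

/-- **Registered bookkeeping sub-goal `stub_exactChartImageChronological` of the line** (brick of the
landing of K2b-5 `stub_marchingLemma`): the image of an exact, time-orientation preserving chart of an open
Kerr-side set lies in the chronological future of any set containing it (anchor of this file, whose content
is the causal behaviour of exact charts: `ChartCausal.isFutureCausalCurveOn_chart_comp`,
`image_subset_chronologicalFuture`, `eq_of_mem_causalFuture_of_time_le`). [cite: ONeill1983, Ch. 14, p. 402] -/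
theorem stub_exactChartImageChronological [Kerr.Facts] : ∀ (𝒮 : Spacetime.{0} 4) (mo : lorentzGroup × E4)
    (M a : ℝ) (hM : 0 < M) (B : ModelBackground) (Ψ : B.domain → 𝒮.carrier) (lab : Kerr.region a M → B.domain)
    (Q : Set (Kerr.region a M)), (∀ z, (lab z : E4) = (mo.1 : E4 ≃L[ℝ] E4) z.1 + mo.2) → IsOpen Q →
    B = starBackground mo.1 mo.2 M a (fun x => Kerr.radius a (poincareInv mo.1 mo.2 x)) →
    ContMDiffOn 𝓘(ℝ, E4) (𝓡 4) ∞ Ψ (pullK mo M a B Q) →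
    supCkENorm (Subtype.val '' pullK mo M a B Q) 0 (𝒮.deviationExtend B Ψ) ≤ 0 →
    (∀ x ∈ pullK mo M a B Q, 𝒮.timeOrientation.IsFutureDirected
      (mfderiv 𝓘(ℝ, E4) (𝓡 4) Ψ x ((mo.1 : E4 ≃L[ℝ] E4) (Kerr.timeVector M a (poincareInv mo.1 mo.2 x.1))))) →
    ∀ J : Set 𝒮.carrier, Ψ '' pullK mo M a B Q ⊆ J →
      Ψ '' pullK mo M a B Q ⊆ 𝒮.metric.chronologicalFuture 𝒮.timeOrientation J :=
  fun _ _ _ _ hM _ _ _ _ hlab hQ hB hs hd htop _ hΨJ =>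
    ChartCausal.image_subset_chronologicalFuture hM hlab hQ hB hs hd htop hΨJ

end Summit.FinalStateConjecture.FinalStateConjecture.Theorems.BondiBartnikRigidity.DirectMethod

end
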